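import Literature.MathematicalPhysics.QuantumFieldTheory.Balaban1983to89.B9Thm39CinvAtCoverDefect
import Literature.MathematicalPhysics.QuantumFieldTheory.Balaban1983to89.B9Thm39CinvAtCoverLarge

/-!
# `Balaban1983to89.B9Thm39CinvAtCoverLargeDefect` — [Balaban1985BackgroundPropagators] THEOREM 3.9 p. 413 ⇒ THEOREM 3.2 (3.48) p. 398 FOR `C(U) = (Q′G′²Q′*)⁻¹(U)`
# AT THE CUBE COVER OF RECORD, «FOR M SUFFICIENTLY LARGE» IN FULL, LOCAL-INVERSE LAW OF THE CUBE LETTERS UP TO A DISPLAYED DEFECT: FILE 13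
# (`B9Thm39CinvAtCoverLarge.cinv_cover_large`) re-run on E1-3 with FOUR smallness terms (cell `lit-balaban`, G-B9-LETTERS module M5.2-E ∕ M5.6, file E1-4 =
# THE END STATEMENT `cinv_cover_large_defect`, seat p21 gen 34; design memo `lit-balaban-p21/M52E-DESIGN-p21.md` v1)

statement-level skeleton of published theorems with citation tags; proofs where landed; nothing here is a claim about the Yang–Mills mass gap

CITATION HEADER (lean-in-tree rule).  B9 = T. Bałaban, *Propagators for lattice gauge theories in a background field*, Commun. Math. Phys. **99** (1985)
389–434 (journal page = PDF page + 388).  p. 409 l. 2–5 («the operators constructed for this sequence … C_□(U) = (Q′(U)G′²_□(U)Q′*(U))⁻¹»); p. 411 (3.95)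
«… = I − R», «By the same estimates as in [4], especially (2.83)–(2.85), we can see that the operator R is small and (Q′G′²Q′*)⁻¹ = C₀(I − R)⁻¹ = Σ C₀Rⁿ (3.96)»;
p. 411 «the part of the exponential factor can be estimated by e^{−¼δ₀M}»; p. 412 (3.97) «estimated by … e^{−2δ₀M} … (2δ₀M)⁻¹», «small factors O(M⁻¹)»; p. 413
Theorem 3.9 «For M sufficiently large … This theorem implies Theorem 3.2»; Thm 3.2 (3.48) p. 398.  [4] = [Balaban1984PropagatorsII] (2.85)–(2.87) p. 238
(«‖R‖ ≦ ½»), Lemma 2.1 (2.66) p. 234.  Rows B9.Thm3.9 × B9.Thm3.2 × B9.Eq3.95 × B9.Eq3.96 (cells only; no row head changes).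

WHY THIS FILE (M5.2-E, memo §3 E1-4).  FILE 13 discharged the located smallness `(θ₁+θ₂+θ₃)c₁ < 1` of module M5.6's end statement above ONE member threshold; with
the local-inverse law of the cube letters holding only up to the displayed defect `E_□` (an (R)-DESIGN TERM, NOT IN PRINT (cell GAPS `G-B9-p21-01`): print's `C_□` is [4] (2.79)–(2.82)'s inverse of the compression of
`□̃Q′G′(□̃)²Q′*□̃` to `𝔅 ∩ □̃` with the GLOBAL averaging `Q′` (p. 411 «in the same way as in (2.82) [4]»; map owner r06 first-hand on CMP 96 p. 237), for which (3.95)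
is an EXACT identity; the tree's cube letter of record `B9CubeLettersBondOpsL0.CCubeY` (lead RULING #5: the SEQUENCE-averaged full inverse `(Q′_□G′²_□Q′_□*)⁻¹` on the
cube sequence's own blocks, chosen to avoid inverse-of-compression decay at a general field; its averaging coincides with the member's on `NearH □ ⊇ supp h_□` only)
satisfies the law only up to the defect `h_□□̃Q′G′²_□(Q′* − Q′*_□)C_□h_□`, of size `e^{−O(δ₀M)}` = the order of print's own (3.97) factors (p. 412 l. 31–35); nothing fails
as printed) there is a FOURTH term `θ₄ = 3·5^{d+1}κ_E e^{−a_Xδ₀D_sep}`, exponentially small in `D_sep = M/(2L²)` like `θ₂`.  THIS FILE re-runs FILE 13 with four terms,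
each `≦ 1/(8c₁)` above an explicit constants-only threshold (FILE 13's `term_exp_small`/`term_inv_small` at `8` instead of `6`), on E1-3's `cinv_cover_above_defect`.

WHAT IS PROVED (all `theorem`s, 0 `def`, 0 sorry, 0 new named facts).  §1 `term_exp_small8`, `term_inv_small8`, `smallness_shape4`;  §2 ★★★ `cinv_cover_large_defect` —
THE END STATEMENT of M5.6 with the defect: `∃ M_L K, 0 ≦ K ∧ ∀ member i, M_L ≦ M_i →` from the `EBlock`s of `G′` and of the cube letters `G′_□`, `IsUnit XY`,
contractive transporters, per cube the law `M_h(M_χ̃XY(G′_□))C_□M_h = M_h² + E_□`, the majorants `hEd` of `E_□`, `hC` of `C_□` ((3.48), un-localized) and `hD` (the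
localized [2]-word) ⟹ `conj b ((η²η²)⁻¹•XinvY) ≺ K·ℓ(a)⁻⁴·e^{−(1−α′)ρδ₀d}`.

HONEST SCOPE / NOT CLAIMED.  Exactly FILE 13's scope with the weakened law (the fourth sum is the (R)-design term above, not a term of print): DISPLAYED per member/letter remain (a) the `EBlock`s (M5.5 ∕ M5.1b-G′), (b) the cube
letters `Cl` with `hdef`/`hEd`/`hC` (M5.2-E supply, memo §3 E2 — the defect majorant and the (3.48) blocks of `C_□` come from the cube sequence's `CCubeY` by
transport, truncation to the common blocks near □ and r05's coarsening; NOT in this file), (c) the LOCALIZED [2]-difference `hD` (cell GAPS G-B9-05 — NOT derived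
in the tree), (d) `IsUnit XY`, `hpar`, `hrepr`; theorem-level: rate data, splits, nonneg constants.  NO cover data, NO geometry, NO threshold bookkeeping, NO located
smallness.  Sup-entry (3.48) only.  Finite 𝕋 member of the k-level V1 family; constants explicit; nothing continuum, nothing about the mass gap; NOT summit
progress.  RELATED, NOT DUPLICATED (searched 2026-08-28: `lean search 'cover_large_defect|smallness_shape4' --decl` = ∅): FILE 13 (exact law; kept), E1-1/E1-2/E1-3.
-/

noncomputable section

namespace Literature.MathematicalPhysics.QuantumFieldTheory.Balaban1983to89.B9Thm39CinvAtCoverLargeDefect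

open Node00 B9CubeLettersInvReadings
open B6Cover236MultiLevelBlocks (cubes)
open B6Cover236MultiLevelTorusBlocks (hB cubeIndT)
open B6Partition118KLevelTorusBinders (sLipT sLipT_nonneg)
open B6Ineq2142KLevelV1 (β)
open B6KLevelCensusIndexV1 (KIdx)
open B6RandomWalk (HasMajorant hasMajorant_mono)
open B9Thm34Ext (toB6)
open B9FromB6 (EBlock)
open B9GeoNormsKLevelV1 (geo9K)
open B9GeoLemma21KLevelV1 (one_le_Mh)
open B9Eq352DivFormLetters (conj)
open B9Thm37CubeCoverCommutators (cutMulY)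
open B9Thm37CubeCoverCommutatorSizes (four_le_P')
open B9Thm39CinvAtCover (chiBigT DsepT lipT)
open B9Thm39CinvAtCoverLarge (term_exp_small term_inv_small DsepT_eq_div lipT_eq)
open B9Thm39CinvAtCoverDefect (cinv_cover_above_defect)

variable {d ℓ : ℕ} {hd : 1 ≤ d + 1} {hL : Odd (ℓ + 1) ∧ 1 < ℓ + 1} {b₀ b₁ : ℝ}
variable {𝔸 : Type} [NormedRing 𝔸] [NormedAlgebra ℂ 𝔸] [CompleteSpace 𝔸]
variable {ι : Type} [Fintype ι] [DecidableEq ι]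

/-! ## §1 Arithmetic of «M sufficiently large» with four terms -/

/-- an exponentially small term against the threshold `8Kc/a ≦ M`: `K·e^{−aM}·c ≦ 1/8` (FILE 13's `term_exp_small` at `(4/3)K`).
[cite: Balaban1985BackgroundPropagators, p.411 («estimated by e^{−¼δ₀M}»), (3.97) p.412 («estimated by (2δ₀M)⁻¹»), bookkeeping] -/
theorem term_exp_small8 {K c a M : ℝ} (hK : 0 ≤ K) (hc : 0 ≤ c) (ha : 0 < a) (hM : 0 < M) (hT : 8 * K * c / a ≤ M) :
    K * Real.exp (-(a * M)) * c ≤ 8⁻¹ := by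
  have hT' : 6 * (4 / 3 * K) * c / a ≤ M := by rw [show 6 * (4 / 3 * K) * c / a = 8 * K * c / a by ring]; exact hT
  have h := term_exp_small (K := 4 / 3 * K) (by positivity) hc ha hM hT'
  nlinarith [h]

/-- an `O(M⁻¹)` term against the threshold `8Kc ≦ M`: `K·M⁻¹·c ≦ 1/8`. [cite: Balaban1985BackgroundPropagators, p.412 («give small factors O(M⁻¹)»), bookkeeping] -/
theorem term_inv_small8 {K c M : ℝ} (hM : 0 < M) (hT : 8 * K * c ≤ M) : K * M⁻¹ * c ≤ 8⁻¹ := by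
  rw [show K * M⁻¹ * c = (K * c) / M by ring, div_le_iff₀ hM]
  nlinarith [hT]

/-- **THE FOUR SUMS OF (3.95)-WITH-DEFECT ARE `≦ ½` AGAINST `c₁` ABOVE THE EXPLICIT THRESHOLDS** (print: «the operator R is small», [4] «‖R‖ ≦ ½»): FILE 13's
`smallness_shape` with the fourth term `θ₄ = N(κ_E·e^{−a_Xδ₀D})`, `a_Xδ₀D = a₄M`: `M ≧ 8K₁c/a₁, 8K₂c/a₂, 8K₃c, 8K₄c/a₄` ⟹ `(θ₁+θ₂+θ₃+θ₄)c ≦ ½`.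
[cite: Balaban1985BackgroundPropagators, (3.95) p.411 + (3.97) p.412 + p.409 l.2–5; Balaban1984PropagatorsII, (2.85) p.238] -/
theorem smallness_shape4 {N P B₀ L4 cb κD κE c asep δ₀ αc aX D lip s M a₁ a₂ a₄ K₁ K₂ K₃ K₄ : ℝ}
    (hK₁0 : 0 ≤ K₁) (hK₂0 : 0 ≤ K₂) (hK₄0 : 0 ≤ K₄) (hc : 0 ≤ c) (ha₁ : 0 < a₁) (ha₂ : 0 < a₂) (ha₄ : 0 < a₄) (hM : 0 < M)
    (hD₁ : asep * δ₀ * D = a₁ * M) (hD₂ : 2 * δ₀ * D = a₂ * M) (hD₄ : aX * δ₀ * D = a₄ * M) (hlip : lip = 2 * s * M⁻¹)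
    (hK₁ : K₁ = N * (P * B₀ * L4 * cb)) (hK₂ : K₂ = N * (κD * B₀ * L4 * cb)) (hK₃ : K₃ = N * ((2 * s * (αc * δ₀)⁻¹) * P * B₀ * L4 * cb))
    (hK₄ : K₄ = N * κE)
    (hT₁ : 8 * K₁ * c / a₁ ≤ M) (hT₂ : 8 * K₂ * c / a₂ ≤ M) (hT₃ : 8 * K₃ * c ≤ M) (hT₄ : 8 * K₄ * c / a₄ ≤ M) :
    (N * (P * B₀ * L4 * cb * Real.exp (-(asep * δ₀ * D))) + N * (κD * Real.exp (-(2 * δ₀ * D)) * B₀ * L4 * cb) +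
      N * ((lip * (αc * δ₀)⁻¹) * P * B₀ * L4 * cb) + N * (κE * Real.exp (-(aX * δ₀ * D)))) * c ≤ 2⁻¹ := by
  have e₁ : N * (P * B₀ * L4 * cb * Real.exp (-(asep * δ₀ * D))) = K₁ * Real.exp (-(a₁ * M)) := by rw [hD₁, hK₁]; ring
  have e₂ : N * (κD * Real.exp (-(2 * δ₀ * D)) * B₀ * L4 * cb) = K₂ * Real.exp (-(a₂ * M)) := by rw [hD₂, hK₂]; ring
  have e₃ : N * ((lip * (αc * δ₀)⁻¹) * P * B₀ * L4 * cb) = K₃ * M⁻¹ := by rw [hlip, hK₃]; ring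
  have e₄ : N * (κE * Real.exp (-(aX * δ₀ * D))) = K₄ * Real.exp (-(a₄ * M)) := by rw [hD₄, hK₄]; ring
  rw [e₁, e₂, e₃, e₄]
  have h₁ := term_exp_small8 hK₁0 hc ha₁ hM hT₁
  have h₂ := term_exp_small8 hK₂0 hc ha₂ hM hT₂
  have h₃ := term_inv_small8 (K := K₃) hM hT₃
  have h₄ := term_exp_small8 hK₄0 hc ha₄ hM hT₄
  nlinarith [h₁, h₂, h₃, h₄]

/-! ## §2 ★★★ (3.48) for `C(U)` at the cube cover of record, «for M sufficiently large» in full, law up to the defect -/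

/-- ★★★ **THEOREM 3.9 ⇒ THEOREM 3.2 (3.48) FOR `C(U) = (Q′G′²Q′*)⁻¹(U)` AT THE CUBE COVER OF RECORD, FOR EVERY MEMBER ABOVE ONE THRESHOLD, MEMBER-INDEPENDENT
CONSTANT, NO LOCATED SMALLNESS — LOCAL-INVERSE LAW OF THE CUBE LETTERS UP TO THE DISPLAYED DEFECT** (FILE 13 `cinv_cover_large` with `hloc ↦ hdef + hEd`; «For M
sufficiently large … the operator R is small … This theorem implies Theorem 3.2»): for the rate data and constants `B_G, B₀, κ_D, κ_E ≧ 0`, `a_sep, a_X > 0`, `α_cδ₀ > 0`,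
the splits, `ρ ≦ a_E` and the target rate, there are `M_L` and `K ≧ 0` (`K = 2·3·5^{d+1}·B₀·c₁(d′, ρδ₀, α′)`) such that for every member `i` with `M_L ≦ M_i`: from the
`EBlock`s of `G′ = O` and of the `G′_□ = Oc □` over the invariant class, the section `ιB`, `IsUnit XY`, contractive transporters, the per-cube local-inverse law up to
the defect `E_□` with its majorant `κ_E·e^{−a_Xδ₀D_sep}·e^{−a_Eδ₀d}`, the un-localized (3.48) blocks of the cube letters `C_□ = Cl □` and the localized [2]-difference
majorants at the cover of record, `conj b ((η²η²)⁻¹•(XinvY i parS O U)) ≺ K·ℓ(a)⁻⁴·e^{−(1−α′)ρδ₀d(a,a′)}`; the FOUR located smallness terms are each driven below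
`1/(8c₁)` by the threshold (`e^{−x} ≦ x⁻¹`).  The fourth sum is the (R)-design term of E1-1 v1.1 ∕ GAPS `G-B9-p21-01` (not in print; nothing fails as printed).
[cite: Balaban1985BackgroundPropagators, Thm 3.9 p.413 + (3.95)–(3.97) pp.411–412 + p.409 l.2–5 + Thm 3.2 (3.48) p.398; Balaban1984PropagatorsII, (2.85)–(2.87) p.238 + Lemma 2.1 (2.66) p.234] -/
theorem cinv_cover_large_defect [∀ i' : KIdx d ℓ hd hL b₀ b₁, Fintype (geo9K i').Site] [∀ i' : KIdx d ℓ hd hL b₀ b₁, DecidableEq (geo9K i').Site]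
    (Rr : KIdx d ℓ hd hL b₀ b₁ → ℝ) (Hp : KIdx d ℓ hd hL b₀ b₁ → Prop) (b : Module.Basis ι ℝ 𝔸)
    {M₂ : ℝ} (hM₂ : 0 ≤ M₂) (hrepr : ∀ (v : 𝔸) (j : ι), |b.repr v j| ≤ M₂ * ‖v‖)
    {δG αG α₂ δ₀ αst bb ρ α' aL aD aE aX αc asep BG B₀ κD κE : ℝ} (hαGδ : 0 < αG * δG) (hα₂0 : 0 < α₂) (hα₂1 : α₂ ≤ 1) (hδG : 0 < (1 - αG) * δG)
    (hδ₀ : 0 < δ₀) (hρ : 0 < ρ) (hρb : ρ < bb) (hα'0 : 0 < α') (hα'1 : α' ≤ 1) (hαst : 0 < αst)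
    (hrate : aL * δ₀ ≤ (1 - α₂) * ((1 - αG) * δG)) (hasep : 0 < asep) (hαc : 0 < αc * δ₀)
    (hsplit₁ : αst + asep + ρ ≤ aL) (hsplit₂ : αst + ρ ≤ aD) (hsplit₃ : αst + αc + ρ ≤ aL) (hρE : ρ ≤ aE) (haX : 0 < aX)
    (hBG : 0 ≤ BG) (hB₀ : 0 ≤ B₀) (hκD : 0 ≤ κD) (hκE : 0 ≤ κE) :
    ∃ ML K : ℝ, 0 ≤ K ∧ ∀ i : KIdx d ℓ hd hL b₀ b₁, ML ≤ (geo9K i).M →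
      ∀ {B : B9.Backgrounds} (cfg : B.Cfg → CfgY 𝔸 i) (O : SiteOpY 𝔸 i) (parS : SiteParY 𝔸 i) {U₁ : B.Cfg} (ιB : BlkY i → IBondY i)
        (Oc : ↥(cubes i.D.toDomains) → SiteOpY 𝔸 i)
        (hE : EBlock (kernelFamilySInv i B cfg O parS) BG δG U₁) (hEc : ∀ c, EBlock (kernelFamilySInv i B cfg (Oc c) parS) BG δG U₁)
        (hι : ∀ s, β i.hN i.D i.hk (ιB s) = s) (hunit : IsUnit (XY i parS O (cfg U₁)))
        (hpar : ∀ z w : SiteY i, ‖(parS (cfg U₁) z w : 𝔸)‖ ≤ 1 ∧ ‖(((parS (cfg U₁) z w)⁻¹ : 𝔸ˣ) : 𝔸)‖ ≤ 1)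
        (Cl E : ↥(cubes i.D.toDomains) → Module.End ℝ (BlkY i → 𝔸))
        (hdef : ∀ c, (cutMulY (𝔸 := 𝔸) (hB i.D c)).restrictScalars ℝ *
          ((cutMulY (𝔸 := 𝔸) (chiBigT i c)).restrictScalars ℝ * (XY i parS (Oc c) (cfg U₁)).restrictScalars ℝ) * Cl c *
            (cutMulY (𝔸 := 𝔸) (hB i.D c)).restrictScalars ℝ =
          (cutMulY (𝔸 := 𝔸) (hB i.D c)).restrictScalars ℝ * (cutMulY (𝔸 := 𝔸) (hB i.D c)).restrictScalars ℝ + E c)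
        (hC : ∀ c, HasMajorant (g := toB6 (geo9K i) (Rr i) (Hp i)) (fun p : BlkY i × ι => ιB p.1) (conj b ((etaS i ^ 2 * etaS i ^ 2)⁻¹ • Cl c))
          (fun a a' => B₀ * ((geo9K i).len a ^ 4)⁻¹ * Real.exp (-(bb * δ₀ * (geo9K i).dist a a'))))
        (hD : ∀ c, HasMajorant (g := toB6 (geo9K i) (Rr i) (Hp i)) (fun p : BlkY i × ι => ιB p.1)
          (conj b ((etaS i ^ 2 * etaS i ^ 2) • ((cutMulY (𝔸 := 𝔸) (chiBigT i c)).restrictScalars ℝ *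
            ((XY i parS O (cfg U₁)).restrictScalars ℝ - (XY i parS (Oc c) (cfg U₁)).restrictScalars ℝ) *
            (cutMulY (𝔸 := 𝔸) (cubeIndT i.D (one_le_Mh i) (four_le_P' i) c)).restrictScalars ℝ)))
          (fun a a'' => κD * Real.exp (-(2 * δ₀ * DsepT i)) * (geo9K i).len a ^ 4 * Real.exp (-(aD * δ₀ * (geo9K i).dist a a''))))
        (hEd : ∀ c, HasMajorant (g := toB6 (geo9K i) (Rr i) (Hp i)) (fun p : BlkY i × ι => ιB p.1) (conj b (E c))
          (fun a a' => κE * Real.exp (-(aX * δ₀ * DsepT i)) * Real.exp (-(aE * δ₀ * (geo9K i).dist a a')))),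
        HasMajorant (g := toB6 (geo9K i) (Rr i) (Hp i)) (fun p : BlkY i × ι => ιB p.1)
          (conj b ((etaS i ^ 2 * etaS i ^ 2)⁻¹ • (XinvY i parS O (cfg U₁)).restrictScalars ℝ))
          (fun a a' => K * ((geo9K i).len a ^ 4)⁻¹ * Real.exp (-((1 - α') * (ρ * δ₀) * (geo9K i).dist a a'))) := by
  obtain ⟨ML, d₂, d', h12⟩ := cinv_cover_above_defect (𝔸 := 𝔸) Rr Hp b hM₂ hrepr hαGδ hα₂0 hα₂1 hδG hδ₀ hρ hρb hα'0 hα'1 hαst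
  -- the constants of the three sums (door exponents fixed)
  have hSb : 0 ≤ ∑ j, ‖b j‖ := Finset.sum_nonneg fun _ _ => norm_nonneg _
  have hc0 : 0 ≤ B6.c1 d' (ρ * δ₀) α' := B6RandomWalk.c1_nonneg _ _ _
  have hcb0 : 0 ≤ B6.c1 d' δ₀ (bb - ρ) := B6RandomWalk.c1_nonneg _ _ _
  have hκG0 : 0 ≤ (M₂ * (∑ j, ‖b j‖) * BG) ^ 2 * ((ℓ : ℝ) + 1) ^ 2 * B6.c1 d₂ ((1 - αG) * δG) α₂ :=
    mul_nonneg (mul_nonneg (sq_nonneg _) (pow_nonneg (by positivity) 2)) (B6RandomWalk.c1_nonneg _ _ _)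
  have hP0 : 0 ≤ (M₂ * ∑ j, ‖b j‖) ^ 2 * ((M₂ * (∑ j, ‖b j‖) * BG) ^ 2 * ((ℓ : ℝ) + 1) ^ 2 * B6.c1 d₂ ((1 - αG) * δG) α₂) :=
    mul_nonneg (sq_nonneg _) hκG0
  have hL40 : 0 ≤ ((ℓ : ℝ) + 1) ^ 4 := pow_nonneg (by positivity) 4
  have hN0 : (0 : ℝ) ≤ 3 * 5 ^ (d + 1) := by positivity
  obtain ⟨K₁, hK₁⟩ : ∃ K₁ : ℝ, K₁ = (3 * 5 ^ (d + 1)) *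
      ((M₂ * ∑ j, ‖b j‖) ^ 2 * ((M₂ * (∑ j, ‖b j‖) * BG) ^ 2 * ((ℓ : ℝ) + 1) ^ 2 * B6.c1 d₂ ((1 - αG) * δG) α₂) * B₀ * ((ℓ : ℝ) + 1) ^ 4 *
        B6.c1 d' δ₀ (bb - ρ)) := ⟨_, rfl⟩
  obtain ⟨K₂, hK₂⟩ : ∃ K₂ : ℝ, K₂ = (3 * 5 ^ (d + 1)) * (κD * B₀ * ((ℓ : ℝ) + 1) ^ 4 * B6.c1 d' δ₀ (bb - ρ)) := ⟨_, rfl⟩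
  obtain ⟨K₃, hK₃⟩ : ∃ K₃ : ℝ, K₃ = (3 * 5 ^ (d + 1)) * ((2 * sLipT d ℓ * (αc * δ₀)⁻¹) *
      ((M₂ * ∑ j, ‖b j‖) ^ 2 * ((M₂ * (∑ j, ‖b j‖) * BG) ^ 2 * ((ℓ : ℝ) + 1) ^ 2 * B6.c1 d₂ ((1 - αG) * δG) α₂)) * B₀ * ((ℓ : ℝ) + 1) ^ 4 *
        B6.c1 d' δ₀ (bb - ρ)) := ⟨_, rfl⟩
  obtain ⟨K₄, hK₄⟩ : ∃ K₄ : ℝ, K₄ = (3 * 5 ^ (d + 1)) * κE := ⟨_, rfl⟩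
  have hK₄0 : 0 ≤ K₄ := by rw [hK₄]; exact mul_nonneg hN0 hκE
  have hK₁0 : 0 ≤ K₁ := by rw [hK₁]; exact mul_nonneg hN0 (mul_nonneg (mul_nonneg (mul_nonneg hP0 hB₀) hL40) hcb0)
  have hK₂0 : 0 ≤ K₂ := by rw [hK₂]; exact mul_nonneg hN0 (mul_nonneg (mul_nonneg (mul_nonneg hκD hB₀) hL40) hcb0)
  have ha₁ : 0 < asep * δ₀ / (2 * ((ℓ : ℝ) + 1) ^ 2) := by positivity
  have ha₂ : 0 < 2 * δ₀ / (2 * ((ℓ : ℝ) + 1) ^ 2) := by positivity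
  have ha₄ : 0 < aX * δ₀ / (2 * ((ℓ : ℝ) + 1) ^ 2) := by positivity
  have hNB : 0 ≤ (3 * 5 ^ (d + 1)) * B₀ * B6.c1 d' (ρ * δ₀) α' := mul_nonneg (mul_nonneg hN0 hB₀) hc0
  refine ⟨max ML (max 1 (max (8 * K₁ * B6.c1 d' (ρ * δ₀) α' / (asep * δ₀ / (2 * ((ℓ : ℝ) + 1) ^ 2)))
      (max (8 * K₂ * B6.c1 d' (ρ * δ₀) α' / (2 * δ₀ / (2 * ((ℓ : ℝ) + 1) ^ 2))) (max (8 * K₃ * B6.c1 d' (ρ * δ₀) α')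
      (8 * K₄ * B6.c1 d' (ρ * δ₀) α' / (aX * δ₀ / (2 * ((ℓ : ℝ) + 1) ^ 2))))))),
    2 * ((3 * 5 ^ (d + 1)) * B₀ * B6.c1 d' (ρ * δ₀) α'), mul_nonneg zero_le_two hNB, fun i hM => ?_⟩
  intro B cfg O parS U₁ ιB Oc hE hEc hι hunit hpar Cl E hdef hC hD hEd
  have hML : ML ≤ (geo9K i).M := (le_max_left _ _).trans hM
  have hM1 : (1 : ℝ) ≤ (geo9K i).M := ((le_max_left _ _).trans (le_max_right _ _)).trans hM
  have hM0 : 0 < (geo9K i).M := lt_of_lt_of_le one_pos hM1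
  have hrest := (le_max_right _ _).trans ((le_max_right _ _).trans hM)
  have hT₁ : 8 * K₁ * B6.c1 d' (ρ * δ₀) α' / (asep * δ₀ / (2 * ((ℓ : ℝ) + 1) ^ 2)) ≤ (geo9K i).M := (le_max_left _ _).trans hrest
  have hT₂ : 8 * K₂ * B6.c1 d' (ρ * δ₀) α' / (2 * δ₀ / (2 * ((ℓ : ℝ) + 1) ^ 2)) ≤ (geo9K i).M :=
    ((le_max_left _ _).trans (le_max_right _ _)).trans hrest
  have hT₃ : 8 * K₃ * B6.c1 d' (ρ * δ₀) α' ≤ (geo9K i).M :=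
    (((le_max_left _ _).trans (le_max_right _ _)).trans (le_max_right _ _)).trans hrest
  have hT₄ : 8 * K₄ * B6.c1 d' (ρ * δ₀) α' / (aX * δ₀ / (2 * ((ℓ : ℝ) + 1) ^ 2)) ≤ (geo9K i).M :=
    (((le_max_right _ _).trans (le_max_right _ _)).trans (le_max_right _ _)).trans hrest
  have hD₁ : asep * δ₀ * DsepT i = asep * δ₀ / (2 * ((ℓ : ℝ) + 1) ^ 2) * (geo9K i).M := by rw [DsepT_eq_div]; ring
  have hD₂ : 2 * δ₀ * DsepT i = 2 * δ₀ / (2 * ((ℓ : ℝ) + 1) ^ 2) * (geo9K i).M := by rw [DsepT_eq_div]; ring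
  have hD₄ : aX * δ₀ * DsepT i = aX * δ₀ / (2 * ((ℓ : ℝ) + 1) ^ 2) * (geo9K i).M := by rw [DsepT_eq_div]; ring
  -- the located smallness of FILE 12, discharged
  have hS : ((3 * 5 ^ (d + 1)) * (((M₂ * ∑ j, ‖b j‖) ^ 2 *
        ((M₂ * (∑ j, ‖b j‖) * BG) ^ 2 * ((ℓ : ℝ) + 1) ^ 2 * B6.c1 d₂ ((1 - αG) * δG) α₂)) * B₀ * ((ℓ : ℝ) + 1) ^ 4 * B6.c1 d' δ₀ (bb - ρ) *
        Real.exp (-(asep * δ₀ * DsepT i))) +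
      (3 * 5 ^ (d + 1)) * (κD * Real.exp (-(2 * δ₀ * DsepT i)) * B₀ * ((ℓ : ℝ) + 1) ^ 4 * B6.c1 d' δ₀ (bb - ρ)) +
      (3 * 5 ^ (d + 1)) * ((lipT i * (αc * δ₀)⁻¹) * ((M₂ * ∑ j, ‖b j‖) ^ 2 *
        ((M₂ * (∑ j, ‖b j‖) * BG) ^ 2 * ((ℓ : ℝ) + 1) ^ 2 * B6.c1 d₂ ((1 - αG) * δG) α₂)) * B₀ * ((ℓ : ℝ) + 1) ^ 4 * B6.c1 d' δ₀ (bb - ρ)) +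
      (3 * 5 ^ (d + 1)) * (κE * Real.exp (-(aX * δ₀ * DsepT i)))) *
      B6.c1 d' (ρ * δ₀) α' ≤ 2⁻¹ :=
    smallness_shape4 hK₁0 hK₂0 hK₄0 hc0 ha₁ ha₂ ha₄ hM0 hD₁ hD₂ hD₄ (lipT_eq i) hK₁ hK₂ hK₃ hK₄ hT₁ hT₂ hT₃ hT₄
  have h := h12 i hML cfg O parS ιB Oc hE hEc hBG hι hunit hpar Cl E hrate hκD hκE hB₀ hasep.le hρE hαc hsplit₁ hsplit₂ hsplit₃ rfl rfl rfl rfl rfl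
    (lt_of_le_of_lt hS (by norm_num)) hdef hC hD hEd
  -- `(1 − (θ₁+θ₂+θ₃+θ₄)c₁)⁻¹ ≦ 2`
  refine hasMajorant_mono (g := toB6 (geo9K i) (Rr i) (Hp i)) _ h fun a a' => ?_
  set S := ((3 * 5 ^ (d + 1)) * (((M₂ * ∑ j, ‖b j‖) ^ 2 *
        ((M₂ * (∑ j, ‖b j‖) * BG) ^ 2 * ((ℓ : ℝ) + 1) ^ 2 * B6.c1 d₂ ((1 - αG) * δG) α₂)) * B₀ * ((ℓ : ℝ) + 1) ^ 4 * B6.c1 d' δ₀ (bb - ρ) *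
        Real.exp (-(asep * δ₀ * DsepT i))) +
      (3 * 5 ^ (d + 1)) * (κD * Real.exp (-(2 * δ₀ * DsepT i)) * B₀ * ((ℓ : ℝ) + 1) ^ 4 * B6.c1 d' δ₀ (bb - ρ)) +
      (3 * 5 ^ (d + 1)) * ((lipT i * (αc * δ₀)⁻¹) * ((M₂ * ∑ j, ‖b j‖) ^ 2 *
        ((M₂ * (∑ j, ‖b j‖) * BG) ^ 2 * ((ℓ : ℝ) + 1) ^ 2 * B6.c1 d₂ ((1 - αG) * δG) α₂)) * B₀ * ((ℓ : ℝ) + 1) ^ 4 * B6.c1 d' δ₀ (bb - ρ)) +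
      (3 * 5 ^ (d + 1)) * (κE * Real.exp (-(aX * δ₀ * DsepT i)))) *
      B6.c1 d' (ρ * δ₀) α' with hSdef
  have hX : (1 - S)⁻¹ ≤ 2 := by
    have h2 : (2 : ℝ)⁻¹ ≤ 1 - S := by linarith [hS]
    calc (1 - S)⁻¹ ≤ ((2 : ℝ)⁻¹)⁻¹ := inv_anti₀ (by norm_num) h2
      _ = 2 := inv_inv 2
  have hW : 0 ≤ ((geo9K i).len a ^ 4)⁻¹ * Real.exp (-((1 - α') * (ρ * δ₀) * (geo9K i).dist a a')) :=
    mul_nonneg (inv_nonneg.mpr (pow_nonneg (B6KLevelCensusIndexV1.len_pos i a).le 4)) (Real.exp_nonneg _)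
  calc (3 * 5 ^ (d + 1)) * B₀ * B6.c1 d' (ρ * δ₀) α' * (1 - S)⁻¹ * ((geo9K i).len a ^ 4)⁻¹ *
        Real.exp (-((1 - α') * (ρ * δ₀) * (geo9K i).dist a a'))
      = ((3 * 5 ^ (d + 1)) * B₀ * B6.c1 d' (ρ * δ₀) α' * (1 - S)⁻¹) *
          (((geo9K i).len a ^ 4)⁻¹ * Real.exp (-((1 - α') * (ρ * δ₀) * (geo9K i).dist a a'))) := by ring
    _ ≤ ((3 * 5 ^ (d + 1)) * B₀ * B6.c1 d' (ρ * δ₀) α' * 2) *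
          (((geo9K i).len a ^ 4)⁻¹ * Real.exp (-((1 - α') * (ρ * δ₀) * (geo9K i).dist a a'))) :=
        mul_le_mul_of_nonneg_right (mul_le_mul_of_nonneg_left hX hNB) hW
    _ = 2 * ((3 * 5 ^ (d + 1)) * B₀ * B6.c1 d' (ρ * δ₀) α') * ((geo9K i).len a ^ 4)⁻¹ *
          Real.exp (-((1 - α') * (ρ * δ₀) * (geo9K i).dist a a')) := by ring


end Literature.MathematicalPhysics.QuantumFieldTheory.Balaban1983to89.B9Thm39CinvAtCoverLargeDefect

end
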